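import Summits.BirchSwinnertonDyer.BirchSwinnertonDyer.Theorems.ByReductionTypeAtTwoRankOneNaiveSigmaLogRecursion
import Literature.IUT.LogVolume.DyadicDiffTwoIsometryStable
import HarnessLib

/-!
# Route `ByReductionTypeAtTwo`, crux `RankOneAtTwoBigImageOddLocal` (item stmt-BirchSwinnertonDyer-23715), line AN62, σ₀-LEMMA BLOCK
# (cell `bsd-f1-sign2`, planner seat `-an` g49; `--supports 23715`, helper; sequel of `…NaiveSigmaLogRecursion`): **the level
# values of `L = log(Σ₀/t²)` on the closed disc `‖t‖₂ ≤ ½` and the order-two vanishing `‖L(t)‖ ≤ ‖t‖²**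

HONEST FRAMING (D-0036/D-0054): THEOREMS ONLY (no definition, no named fact, no `sorry`, no instance); statements about the formal
group of a Weierstrass model over `ℚ₂` (`a₁ = 0`, `a₂, a₃, a₄, a₆ ∈ ℤ₂`), NOT about `BSDp`; item 23715 stays OPEN; BSD is proved for
no curve.  Gate-backed forms of the workfile theorems 50B / 53C of `Cruxes/RankOneAtTwoBigImageOddLocal/WildPairHeightAN62.lean`
§6–§7 (-an g49).  With `Σ₀`, `L` as in `naiveSigmaLog_denominators_two` (`[t²]Σ₀ = 1`, `[t³]Σ₀ = 0`, `SatisfiesSigmaSqODE Σ₀ 0`,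
`L(0) = 0`, `S·L′ = S′`):

* §1 `DyadicDiffTwo.padic_norm_sub_one_le` — a `2`-adic unit is `≡ 1 (mod 2)`.
* §2 **`naiveSigmaLog_values_two`** (50B) — for `‖t‖ ≤ ½`: `Σ l_k t^k` is summable; at `‖t‖ = ½`,
  `‖L(t) − (4a₂ + 8(a₃ + a₂² + a₄))‖ ≤ 2⁻⁴`; at `‖t‖ ≤ ¼`, `‖L(t) − a₂t²‖ ≤ 2⁻⁶` (the «`λ₂ ≡ −4a₂ (mod 8)` at level 1» alphabet).
* §2 **`norm_padicEval_le_normSq_of_sigmaLog`** (53C) — `‖L(t)‖ ≤ ‖t‖²` for every `‖t‖ ≤ ½`.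

PLACEMENT (REF2 v75-add3 ccd6a0549646a9f7): not found in print («beyond-print yes-small», workfile level); nearest print Bernardi 1981 §1
(naive σ-heights, every `p`), MST06 Thm. 1.3.  References: [cite: MazurSteinTate2006, Thm. 1.3] [cite: Bernardi1981, §1]
[cite: SilvermanAEC2009, IV.1.1].
-/

set_option autoImplicit false

noncomputable section

open scoped Classical

open PowerSeries WeierstrassCurve Literature.NumberTheory.EllipticCurves

namespace Summit.BirchSwinnertonDyer.BirchSwinnertonDyer.Theorems

namespace NaiveSigmaLogAtTwo

/-! ### §1 50B — level values of `L` -/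

/-- **50B `naiveSigmaLog_values_two`** (kernel): summability of `Σ l_k t^k` on `‖t‖ ≤ ½` and the level values.  Proof: by 50A,
`‖l_k‖ ≤ k²` for all `k` (so the series is dominated by `k²‖t‖^k`, `summable_pow_mul_geometric_of_norm_lt_one`) and
`‖l_k‖ ≤ 2^{k−4}` for `k ≥ 5` (`padicValNat_add_log_add_three_le`), so every term with `k ≥ 5` has norm `≤ 2⁻⁴` at `‖t‖ ≤ ½`
and `≤ 2^{−k−4}` at `‖t‖ ≤ ¼`; split the `tsum` (`Summable.sum_add_tsum_nat_add`) at `5`, resp. `3`, bound the tail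
ultrametrically (`IsUltrametricDist.norm_tsum_le_of_forall_le_of_nonneg`) and the head by the unit congruences
`‖t ∓ 2‖ ≤ ¼`, `‖t² − 4‖ ≤ 1/16`, `‖t³ − 8‖ ≤ 1/16`, `‖t⁴ − 16‖ ≤ 1/128` (`DyadicDiffTwo.padic_norm_sub_one_le`: a `2`-adic unit is
`≡ 1 (mod 2)`).  [cite: Bernardi1981, §1] [cite: MazurSteinTate2006, Thm. 1.3] -/
theorem naiveSigmaLog_values_two (W : WeierstrassCurve ℚ_[2]) (Sq L : ℚ_[2]⟦X⟧) (t : ℚ_[2])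
    (ha1 : W.a₁ = 0) (ha2 : ‖W.a₂‖ ≤ 1) (ha3 : ‖W.a₃‖ ≤ 1) (ha4 : ‖W.a₄‖ ≤ 1) (ha6 : ‖W.a₆‖ ≤ 1)
    (h2 : coeff 2 Sq = 1) (h3 : coeff 3 Sq = 0) (hODE : W.SatisfiesSigmaSqODE Sq 0) (hL0 : constantCoeff L = 0)
    (hL : sigmaShift (sigmaShift Sq) * d⁄dX ℚ_[2] L = d⁄dX ℚ_[2] (sigmaShift (sigmaShift Sq))) (ht : ‖t‖ ≤ 2⁻¹) :
    Summable (fun n : ℕ => coeff n L * t ^ n) ∧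
    (‖t‖ = 2⁻¹ → ‖padicEval L t - (4 * W.a₂ + 8 * (W.a₃ + W.a₂ ^ 2 + W.a₄))‖ ≤ (2⁻¹ : ℝ) ^ 4) ∧
    (‖t‖ ≤ (2⁻¹ : ℝ) ^ 2 → ‖padicEval L t - W.a₂ * t ^ 2‖ ≤ (2⁻¹ : ℝ) ^ 6) := by
  obtain ⟨hl1, hl2, hl3, hl4, hbound⟩ := naiveSigmaLog_denominators_two W Sq L ha1 ha2 ha3 ha4 ha6 h2 h3 hODE hL
  have hl0 : coeff 0 L = 0 := by rw [coeff_zero_eq_constantCoeff]; exact hL0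
  have ht0 : 0 ≤ ‖t‖ := norm_nonneg t
  -- small norms
  have h2 : ‖(2 : ℚ_[2])‖ = 2⁻¹ := by exact_mod_cast (Padic.norm_p (p := 2))
  have h3 : ‖(3 : ℚ_[2])‖ = 1 := by
    rw [show (3 : ℚ_[2]) = ((3 : ℕ) : ℚ_[2]) by norm_num, Padic.norm_natCast_eq_one_iff]; decide
  have h5 : ‖(5 : ℚ_[2])‖ = 1 := by
    rw [show (5 : ℚ_[2]) = ((5 : ℕ) : ℚ_[2]) by norm_num, Padic.norm_natCast_eq_one_iff]; decide
  have h6 : ‖(6 : ℚ_[2])‖ = 2⁻¹ := by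
    rw [show (6 : ℚ_[2]) = 2 * 3 by norm_num, norm_mul, h2, h3, mul_one]
  have h4 : ‖(4 : ℚ_[2])‖ = 4⁻¹ := by
    rw [show (4 : ℚ_[2]) = 2 * 2 by norm_num, norm_mul, h2]; norm_num
  have h8 : ‖(8 : ℚ_[2])‖ = 8⁻¹ := by
    rw [show (8 : ℚ_[2]) = 2 * 2 * 2 by norm_num, norm_mul, norm_mul, h2]; norm_num
  have h32 : ‖(32 : ℚ_[2])‖ = 32⁻¹ := by
    rw [show (32 : ℚ_[2]) = 2 * 2 * 2 * 2 * 2 by norm_num, norm_mul, norm_mul, norm_mul, norm_mul, h2]; norm_num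
  -- ‖l₄‖ ≤ 2
  have hl4n : ‖coeff 4 L‖ ≤ 2 := by
    rw [hl4]
    refine (IsUltrametricDist.norm_add_le_max _ _).trans (max_le ?_ ?_)
    · rw [norm_div, h2, norm_pow]
      calc ‖W.a₂‖ ^ 2 / 2⁻¹ = ‖W.a₂‖ ^ 2 * 2 := by ring
        _ ≤ 1 ^ 2 * 2 := by gcongr
        _ = 2 := by ring
    · rw [norm_div, norm_mul, h5, h6, one_mul]
      calc ‖W.a₄‖ / 2⁻¹ = ‖W.a₄‖ * 2 := by ring
        _ ≤ 1 * 2 := by gcongr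
        _ = 2 := by ring
  -- ‖l_k‖ ≤ 2^{k−4} for k ≥ 5
  have hlk : ∀ k : ℕ, 5 ≤ k → ‖coeff k L‖ ≤ (2 : ℝ) ^ (k - 4) := by
    intro k hk
    have hb := hbound k (by omega)
    have he := padicValNat_add_log_add_three_le hk
    have hpow : (2 : ℝ) ^ (padicValNat 2 k + Nat.log 2 (k - 1)) ≤ 2 ^ (k - 4) * 2 := by
      rw [← pow_succ]
      exact pow_le_pow_right₀ (by norm_num) (by omega)
    nlinarith [hb, hpow, norm_nonneg (coeff k L)]
  -- every term is bounded by `k² ‖t‖^k`: summability on the closed disc `‖t‖ ≤ ½`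
  have hterm : ∀ k : ℕ, ‖coeff k L * t ^ k‖ ≤ (k : ℝ) ^ 2 * ‖t‖ ^ k := by
    intro k
    rw [norm_mul, norm_pow]
    refine mul_le_mul_of_nonneg_right ?_ (pow_nonneg ht0 k)
    rcases Nat.lt_or_ge k 3 with hk | hk
    · interval_cases k
      · rw [hl0, norm_zero]; positivity
      · rw [hl1, norm_zero]; positivity
      · rw [hl2]; norm_num; linarith
    · have hb := hbound k hk
      have hv : 2 ^ padicValNat 2 k ≤ k := Nat.le_of_dvd (by omega) pow_padicValNat_dvd
      have hlg : 2 ^ Nat.log 2 (k - 1) ≤ k - 1 := Nat.pow_log_le_self 2 (by omega)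
      have hcast : (2 : ℝ) ^ (padicValNat 2 k + Nat.log 2 (k - 1)) ≤ (k : ℝ) * k := by
        rw [pow_add]
        have e1 : ((2 ^ padicValNat 2 k : ℕ) : ℝ) ≤ k := by exact_mod_cast hv
        have e2 : ((2 ^ Nat.log 2 (k - 1) : ℕ) : ℝ) ≤ k := by exact_mod_cast hlg.trans (Nat.sub_le k 1)
        push_cast at e1 e2
        exact mul_le_mul e1 e2 (by positivity) (by positivity)
      nlinarith [hb, hcast, norm_nonneg (coeff k L)]
  have hsum : Summable (fun n : ℕ => coeff n L * t ^ n) := by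
    refine Summable.of_norm_bounded (summable_pow_mul_geometric_of_norm_lt_one 2
      (show ‖(‖t‖ : ℝ)‖ < 1 by rw [norm_norm]; linarith)) fun k => ?_
    exact hterm k
  -- geometric bookkeeping: `2^{k−4} · 2^{−k} = 2^{−4}` (`k ≥ 5`)
  have hgeom : ∀ k : ℕ, 5 ≤ k → (2 : ℝ) ^ (k - 4) * (2⁻¹ : ℝ) ^ k = (2⁻¹ : ℝ) ^ 4 := by
    intro k hk
    obtain ⟨j, rfl⟩ : ∃ j, k = j + 4 := ⟨k - 4, by omega⟩
    rw [Nat.add_sub_cancel, pow_add, ← mul_assoc, ← mul_pow, mul_inv_cancel₀ (two_ne_zero), one_pow, one_mul]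
  -- tail terms: ‖l_k t^k‖ ≤ 2^{−4} for k ≥ 5 when ‖t‖ ≤ ½
  have htail : ∀ k : ℕ, 5 ≤ k → ‖coeff k L * t ^ k‖ ≤ (2⁻¹ : ℝ) ^ 4 := by
    intro k hk
    rw [norm_mul, norm_pow, ← hgeom k hk]
    exact mul_le_mul (hlk k hk) (pow_le_pow_left₀ ht0 ht k) (pow_nonneg ht0 k) (by positivity)
  refine ⟨hsum, fun ht1 => ?_, fun ht2 => ?_⟩
  · -- ‖t‖ = ½ : `L(t) ≡ 4a₂ + 8(a₃ + a₂² + a₄) (mod 16)`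
    have hu : ‖t / 2‖ = 1 := by rw [norm_div, ht1, h2, div_self (by norm_num)]
    have hu1 : ‖t / 2 - 1‖ ≤ 2⁻¹ := Literature.IUT.LogVolume.DyadicDiffTwo.padic_norm_sub_one_le hu
    have htm : ‖t - 2‖ ≤ 4⁻¹ := by
      rw [show t - 2 = 2 * (t / 2 - 1) by ring, norm_mul, h2]
      calc (2⁻¹ : ℝ) * ‖t / 2 - 1‖ ≤ 2⁻¹ * 2⁻¹ := by gcongr
        _ = 4⁻¹ := by norm_num
    have htp : ‖t + 2‖ ≤ 4⁻¹ := by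
      rw [show t + 2 = (t - 2) + 4 by ring]
      refine (IsUltrametricDist.norm_add_le_max _ _).trans (max_le htm ?_)
      rw [h4]
    have hsq : ‖t ^ 2 - 4‖ ≤ 16⁻¹ := by
      rw [show t ^ 2 - 4 = (t - 2) * (t + 2) by ring, norm_mul]
      calc ‖t - 2‖ * ‖t + 2‖ ≤ 4⁻¹ * 4⁻¹ :=
            mul_le_mul htm htp (norm_nonneg _) (by norm_num)
        _ = 16⁻¹ := by norm_num
    have hsq' : ‖t ^ 2 + 4‖ ≤ 8⁻¹ := by
      rw [show t ^ 2 + 4 = (t ^ 2 - 4) + 8 by ring]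
      refine (IsUltrametricDist.norm_add_le_max _ _).trans (max_le (hsq.trans (by norm_num)) ?_)
      rw [h8]
    have hfour : ‖t ^ 4 - 16‖ ≤ 128⁻¹ := by
      rw [show t ^ 4 - 16 = (t ^ 2 - 4) * (t ^ 2 + 4) by ring, norm_mul]
      calc ‖t ^ 2 - 4‖ * ‖t ^ 2 + 4‖ ≤ 16⁻¹ * 8⁻¹ :=
            mul_le_mul hsq hsq' (norm_nonneg _) (by norm_num)
        _ = 128⁻¹ := by norm_num
    have hcube : ‖t ^ 3 - 8‖ ≤ 16⁻¹ := by
      rw [show t ^ 3 - 8 = (t - 2) * (t * t + 2 * t + 4) by ring, norm_mul]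
      have hq : ‖t * t + 2 * t + 4‖ ≤ 4⁻¹ := by
        refine (IsUltrametricDist.norm_add_le_max _ _).trans (max_le ?_ (by rw [h4]))
        refine (IsUltrametricDist.norm_add_le_max _ _).trans (max_le ?_ ?_)
        · rw [norm_mul, ht1]; norm_num
        · rw [norm_mul, h2, ht1]; norm_num
      calc ‖t - 2‖ * ‖t * t + 2 * t + 4‖ ≤ 4⁻¹ * 4⁻¹ :=
            mul_le_mul htm hq (norm_nonneg _) (by norm_num)
        _ = 16⁻¹ := by norm_num
    -- the four head differences
    have d1 : ‖W.a₂ * t ^ 2 - 4 * W.a₂‖ ≤ 16⁻¹ := by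
      rw [show W.a₂ * t ^ 2 - 4 * W.a₂ = W.a₂ * (t ^ 2 - 4) by ring, norm_mul]
      calc ‖W.a₂‖ * ‖t ^ 2 - 4‖ ≤ 1 * 16⁻¹ := mul_le_mul ha2 hsq (norm_nonneg _) (by norm_num)
        _ = 16⁻¹ := by ring
    have d2 : ‖W.a₃ * t ^ 3 - 8 * W.a₃‖ ≤ 16⁻¹ := by
      rw [show W.a₃ * t ^ 3 - 8 * W.a₃ = W.a₃ * (t ^ 3 - 8) by ring, norm_mul]
      calc ‖W.a₃‖ * ‖t ^ 3 - 8‖ ≤ 1 * 16⁻¹ := mul_le_mul ha3 hcube (norm_nonneg _) (by norm_num)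
        _ = 16⁻¹ := by ring
    have d3 : ‖W.a₂ ^ 2 / 2 * t ^ 4 - 8 * W.a₂ ^ 2‖ ≤ 16⁻¹ := by
      rw [show W.a₂ ^ 2 / 2 * t ^ 4 - 8 * W.a₂ ^ 2 = W.a₂ ^ 2 / 2 * (t ^ 4 - 16) by ring, norm_mul, norm_div,
        norm_pow, h2]
      calc ‖W.a₂‖ ^ 2 / 2⁻¹ * ‖t ^ 4 - 16‖ ≤ 1 ^ 2 / 2⁻¹ * 128⁻¹ := by gcongr
        _ ≤ 16⁻¹ := by norm_num
    have d4 : ‖5 * W.a₄ / 6 * t ^ 4 - 8 * W.a₄‖ ≤ 16⁻¹ := by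
      rw [show 5 * W.a₄ / 6 * t ^ 4 - 8 * W.a₄ = W.a₄ / 6 * (5 * (t ^ 4 - 16) + 32) by ring, norm_mul,
        norm_div, h6]
      have hq : ‖5 * (t ^ 4 - 16) + (32 : ℚ_[2])‖ ≤ 32⁻¹ := by
        refine (IsUltrametricDist.norm_add_le_max _ _).trans (max_le ?_ (by rw [h32]))
        rw [norm_mul, h5, one_mul]
        exact hfour.trans (by norm_num)
      calc ‖W.a₄‖ / 2⁻¹ * ‖5 * (t ^ 4 - 16) + 32‖ ≤ 1 / 2⁻¹ * 32⁻¹ := by gcongr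
        _ = 16⁻¹ := by norm_num
    -- split the sum at `5`
    unfold padicEval
    rw [← hsum.sum_add_tsum_nat_add 5]
    simp only [Finset.sum_range_succ, Finset.sum_range_zero, zero_add, hl0, hl1, hl2, hl3, hl4, zero_mul,
      pow_zero, pow_one]
    have htl : ‖∑' i : ℕ, coeff (i + 5) L * t ^ (i + 5)‖ ≤ (2⁻¹ : ℝ) ^ 4 :=
      IsUltrametricDist.norm_tsum_le_of_forall_le_of_nonneg (by positivity) fun i => htail (i + 5) (by omega)
    have hhead : ‖W.a₂ * t ^ 2 + W.a₃ * t ^ 3 + (W.a₂ ^ 2 / 2 + 5 * W.a₄ / 6) * t ^ 4 -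
        (4 * W.a₂ + 8 * (W.a₃ + W.a₂ ^ 2 + W.a₄))‖ ≤ 16⁻¹ := by
      rw [show W.a₂ * t ^ 2 + W.a₃ * t ^ 3 + (W.a₂ ^ 2 / 2 + 5 * W.a₄ / 6) * t ^ 4 -
          (4 * W.a₂ + 8 * (W.a₃ + W.a₂ ^ 2 + W.a₄)) =
          (W.a₂ * t ^ 2 - 4 * W.a₂) + (W.a₃ * t ^ 3 - 8 * W.a₃) + (W.a₂ ^ 2 / 2 * t ^ 4 - 8 * W.a₂ ^ 2) +
            (5 * W.a₄ / 6 * t ^ 4 - 8 * W.a₄) by ring]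
      refine (IsUltrametricDist.norm_add_le_max _ _).trans (max_le ?_ d4)
      refine (IsUltrametricDist.norm_add_le_max _ _).trans (max_le ?_ d3)
      exact (IsUltrametricDist.norm_add_le_max _ _).trans (max_le d1 d2)
    rw [show ∀ (A B C : ℚ_[2]), A + B - C = (A - C) + B from fun A B C => by ring]
    refine (IsUltrametricDist.norm_add_le_max _ _).trans (max_le (hhead.trans (by norm_num)) htl)
  · -- ‖t‖ ≤ ¼ : `L(t) ≡ a₂t² (mod 64)`
    unfold padicEval
    rw [← hsum.sum_add_tsum_nat_add 3]
    simp only [Finset.sum_range_succ, Finset.sum_range_zero, zero_add, hl0, hl1, hl2, zero_mul, add_sub_cancel_left]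
    refine IsUltrametricDist.norm_tsum_le_of_forall_le_of_nonneg (by positivity) fun i => ?_
    rw [norm_mul, norm_pow]
    rcases Nat.lt_or_ge i 2 with hi | hi
    · interval_cases i
      · rw [zero_add, hl3]
        calc ‖W.a₃‖ * ‖t‖ ^ 3 ≤ 1 * ((2⁻¹ : ℝ) ^ 2) ^ 3 := by gcongr
          _ = (2⁻¹ : ℝ) ^ 6 := by norm_num
      · calc ‖coeff (1 + 3) L‖ * ‖t‖ ^ (1 + 3) ≤ 2 * ((2⁻¹ : ℝ) ^ 2) ^ (1 + 3) :=
            mul_le_mul hl4n (pow_le_pow_left₀ ht0 ht2 _) (pow_nonneg ht0 _) (by positivity)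
          _ ≤ (2⁻¹ : ℝ) ^ 6 := by norm_num
    · have hk : 5 ≤ i + 3 := by omega
      have htk : ‖t‖ ^ (i + 3) ≤ (2⁻¹ : ℝ) ^ (i + 3) * (2⁻¹ : ℝ) ^ (i + 3) := by
        calc ‖t‖ ^ (i + 3) ≤ ((2⁻¹ : ℝ) ^ 2) ^ (i + 3) := pow_le_pow_left₀ ht0 ht2 _
          _ = (2⁻¹ : ℝ) ^ (i + 3) * (2⁻¹ : ℝ) ^ (i + 3) := by rw [← pow_mul, two_mul, pow_add]
      have hsmall : (2⁻¹ : ℝ) ^ (i + 3) ≤ (2⁻¹ : ℝ) ^ 2 :=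
        pow_le_pow_of_le_one (by norm_num) (by norm_num) (by omega)
      calc ‖coeff (i + 3) L‖ * ‖t‖ ^ (i + 3)
          ≤ (2 : ℝ) ^ (i + 3 - 4) * ((2⁻¹ : ℝ) ^ (i + 3) * (2⁻¹ : ℝ) ^ (i + 3)) :=
            mul_le_mul (hlk _ hk) htk (pow_nonneg ht0 _) (by positivity)
        _ = ((2 : ℝ) ^ (i + 3 - 4) * (2⁻¹ : ℝ) ^ (i + 3)) * (2⁻¹ : ℝ) ^ (i + 3) := by ring
        _ = (2⁻¹ : ℝ) ^ 4 * (2⁻¹ : ℝ) ^ (i + 3) := by rw [hgeom _ hk]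
        _ ≤ (2⁻¹ : ℝ) ^ 4 * (2⁻¹ : ℝ) ^ 2 := mul_le_mul_of_nonneg_left hsmall (by positivity)
        _ = (2⁻¹ : ℝ) ^ 6 := by norm_num

/-! ### §2 53C — `L` vanishes to order two on the disc -/

/-- **`L` VANISHES TO ORDER TWO ON THE WHOLE DISC** (kernel; generic form over the hypotheses of 50B): `‖L(t)‖ ≤ ‖t‖²` for every
`‖t‖ ≤ ½` — termwise `‖l_k t^k‖ ≤ ‖t‖²` (`l₀ = l₁ = 0`; `‖a₂‖, ‖a₃‖ ≤ 1`; `‖l₄‖ ≤ 2` against `‖t‖² ≤ ¼`; `‖l_k‖ ≤ 2^{k−4}` for `k ≥ 5`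
against `‖t‖^{k−2} ≤ 2^{2−k}`), then the ultrametric `tsum` bound.  At level `≥ 4` (`‖t‖ ≤ 2⁻⁴`) this is the `‖L(t)‖ ≤ 2⁻⁸` that 50H
consumes. [cite: Bernardi1981, §1] -/
theorem norm_padicEval_le_normSq_of_sigmaLog (W : WeierstrassCurve ℚ_[2]) (Sq L : ℚ_[2]⟦X⟧) (t : ℚ_[2]) (ha1 : W.a₁ = 0)
    (ha2 : ‖W.a₂‖ ≤ 1) (ha3 : ‖W.a₃‖ ≤ 1) (ha4 : ‖W.a₄‖ ≤ 1) (ha6 : ‖W.a₆‖ ≤ 1)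
    (h2 : coeff 2 Sq = 1) (h3 : coeff 3 Sq = 0) (hODE : W.SatisfiesSigmaSqODE Sq 0) (hL0 : constantCoeff L = 0)
    (hL : sigmaShift (sigmaShift Sq) * d⁄dX ℚ_[2] L = d⁄dX ℚ_[2] (sigmaShift (sigmaShift Sq))) (ht : ‖t‖ ≤ 2⁻¹) :
    ‖padicEval L t‖ ≤ ‖t‖ ^ 2 := by
  obtain ⟨hl1, hl2, hl3, hl4, hbound⟩ := naiveSigmaLog_denominators_two W Sq L ha1 ha2 ha3 ha4 ha6 h2 h3 hODE hL
  have hl0 : coeff 0 L = 0 := by rw [coeff_zero_eq_constantCoeff]; exact hL0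
  have ht0 : 0 ≤ ‖t‖ := norm_nonneg t
  have ht1 : ‖t‖ ≤ 1 := ht.trans (by norm_num)
  have h2 : ‖(2 : ℚ_[2])‖ = 2⁻¹ := by exact_mod_cast (Padic.norm_p (p := 2))
  have h3 : ‖(3 : ℚ_[2])‖ = 1 := by
    rw [show (3 : ℚ_[2]) = ((3 : ℕ) : ℚ_[2]) by norm_num, Padic.norm_natCast_eq_one_iff]; decide
  have h5 : ‖(5 : ℚ_[2])‖ = 1 := by
    rw [show (5 : ℚ_[2]) = ((5 : ℕ) : ℚ_[2]) by norm_num, Padic.norm_natCast_eq_one_iff]; decide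
  have h6 : ‖(6 : ℚ_[2])‖ = 2⁻¹ := by
    rw [show (6 : ℚ_[2]) = 2 * 3 by norm_num, norm_mul, h2, h3, mul_one]
  -- ‖l₄‖ ≤ 2
  have hl4n : ‖coeff 4 L‖ ≤ 2 := by
    rw [hl4]
    refine (IsUltrametricDist.norm_add_le_max _ _).trans (max_le ?_ ?_)
    · rw [norm_div, h2, norm_pow]
      calc ‖W.a₂‖ ^ 2 / 2⁻¹ = ‖W.a₂‖ ^ 2 * 2 := by ring
        _ ≤ 1 ^ 2 * 2 := by gcongr
        _ = 2 := by ring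
    · rw [norm_div, norm_mul, h5, h6, one_mul]
      calc ‖W.a₄‖ / 2⁻¹ = ‖W.a₄‖ * 2 := by ring
        _ ≤ 1 * 2 := by gcongr
        _ = 2 := by ring
  -- ‖l_k‖ ≤ 2^{k−4} for k ≥ 5
  have hlk : ∀ k : ℕ, 5 ≤ k → ‖coeff k L‖ ≤ (2 : ℝ) ^ (k - 4) := by
    intro k hk
    have hb := hbound k (by omega)
    have he := padicValNat_add_log_add_three_le hk
    have hpow : (2 : ℝ) ^ (padicValNat 2 k + Nat.log 2 (k - 1)) ≤ 2 ^ (k - 4) * 2 := by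
      rw [← pow_succ]
      exact pow_le_pow_right₀ (by norm_num) (by omega)
    nlinarith [hb, hpow, norm_nonneg (coeff k L)]
  unfold padicEval
  refine IsUltrametricDist.norm_tsum_le_of_forall_le_of_nonneg (pow_nonneg ht0 2) fun k => ?_
  rw [norm_mul, norm_pow]
  rcases Nat.lt_or_ge k 5 with hk | hk
  · interval_cases k
    · rw [hl0, norm_zero, zero_mul]; positivity
    · rw [hl1, norm_zero, zero_mul]; positivity
    · rw [hl2]; exact mul_le_of_le_one_left (pow_nonneg ht0 2) ha2
    · rw [hl3]
      calc ‖W.a₃‖ * ‖t‖ ^ 3 ≤ 1 * ‖t‖ ^ 2 :=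
            mul_le_mul ha3 (pow_le_pow_of_le_one ht0 ht1 (by norm_num)) (by positivity) zero_le_one
        _ = ‖t‖ ^ 2 := one_mul _
    · rw [show ‖t‖ ^ 4 = ‖t‖ ^ 2 * ‖t‖ ^ 2 by ring, ← mul_assoc]
      refine mul_le_of_le_one_left (pow_nonneg ht0 2) ?_
      calc ‖coeff 4 L‖ * ‖t‖ ^ 2 ≤ 2 * (2⁻¹ : ℝ) ^ 2 :=
            mul_le_mul hl4n (pow_le_pow_left₀ ht0 ht 2) (by positivity) (by positivity)
        _ ≤ 1 := by norm_num
  · obtain ⟨j, rfl⟩ : ∃ j, k = j + 5 := ⟨k - 5, by omega⟩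
    have hl := hlk (j + 5) (by omega)
    rw [show j + 5 - 4 = j + 1 from by omega] at hl
    rw [show ‖t‖ ^ (j + 5) = ‖t‖ ^ (j + 3) * ‖t‖ ^ 2 by ring, ← mul_assoc]
    refine mul_le_of_le_one_left (pow_nonneg ht0 2) ?_
    calc ‖coeff (j + 5) L‖ * ‖t‖ ^ (j + 3) ≤ 2 ^ (j + 1) * (2⁻¹ : ℝ) ^ (j + 3) :=
          mul_le_mul hl (pow_le_pow_left₀ ht0 ht _) (pow_nonneg ht0 _) (by positivity)
      _ = (2⁻¹ : ℝ) ^ 2 := by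
          rw [pow_add (2⁻¹ : ℝ) (j + 1) 2, ← mul_assoc, ← mul_pow, mul_inv_cancel₀ two_ne_zero, one_pow, one_mul]
      _ ≤ 1 := by norm_num

end NaiveSigmaLogAtTwo

end Summit.BirchSwinnertonDyer.BirchSwinnertonDyer.Theorems
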